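import Literature.NumberTheory.Automorphic.GodementJacquetRankOneEntire
import Literature.NumberTheory.Automorphic.PairLFunctionMeromorphicContinuationProofs
import Literature.NumberTheory.Automorphic.PairLFunctionPolesRankNeLandau
import Literature.NumberTheory.Automorphic.PairLFunctionPolesGLOneTateProofs
import Literature.NumberTheory.Automorphic.AdelicGroupDataAutomorphicMeasureProofs
import HarnessLib

/-!
# Arthur–Clozel (2.2) at `s = 1` in rank one over every number field, unconditionally;
# Hecke–Landau: `L^S(1, ψ) ≠ 0` for the Hecke characters of `L²(GL_1)`

Topic `NumberTheory/Automorphic`; namespace `Literature.NumberTheory.Automorphic`. Proof file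
(theorems only: no definition, no named fact, no instance) under the named fact
`JacquetShalika1981_partialPairL_at_one_of_ne_conj` of `PairLFunctionPoles` — Arthur–Clozel,
*Simple algebras, base change, and the advanced theory of the trace formula*, Ann. of Math.
Stud. 120 (1989), Ch. 3 §2, (2.2), p. 171 of the held copy: for unitary cuspidal `π ≇ σ̃` on
`GL_n(𝔸_K)`, `L^S(s, π ⊗ σ)` "extends continuously to the line `Re s = 1` with `X` removed.
Moreover, it does not vanish there" (cf. Jacquet–Shalika II, Prop. 3.6; "the non-vanishing part of
these results is due to Shahidi"), at the point `s₀ = 1`.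

**The case `n = 1` is now a theorem of the tree over every number field `K`, with no hypothesis**
(`JacquetShalika1981_partialPairL_at_one_of_ne_conj_one`). The earlier rank-one files proved it
for `K = ℚ` (`…_one_rat`, Dirichlet `L`-functions) and, over `K`, granted Hecke's continuation
theorem in the tree's form `heckeLFunction_hasEntireContinuation_of_not_isNormTwist`
(`…_one_of_tate`). Since then two inputs have landed:

* `MoeglinWaldspurger1989_partialPairL_entire_of_ne_conj_one` (`GodementJacquetRankOneEntire`):
  Mœglin–Waldspurger's Corollaire (i)(b) in rank one — `L^S(s, π × π')` is entire for `π ≠ π̄'` —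
  i.e. Hecke's theorem that `L^S(s, ψ)` is entire for a unitary `ψ ≠ 1` trivial on `A_G`, proved
  from the Godement–Jacquet (Tate) zeta integrals of `GL_1`;
* `MoeglinWaldspurger1989_partialPairL_of_eq_conj_one` (`PairLFunctionMeromorphicContinuationProofs`):
  Corollaire (ii) in rank one — `s (s - 1) ζ_K^S(s)` is entire (Hecke);

and `JacquetShalika1981_partialPairL_at_one_of_ne_conj_of_moeglinWaldspurger`
(`PairLFunctionPolesRankNeLandau`) derives the fact at rank `n` from exactly these two continuation
statements at rank `n`, the non-vanishing at `s = 1` being de la Vallée Poussin's positivity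
argument with Landau's lemma (`partialPairL_continuation_apply_one_ne_zero`; for `n = 1` this is
Landau's proof of `L(1, ψ) ≠ 0`, `HeckeLFunctionNonvanishingProofs`). So:

* `JacquetShalika1981_partialPairL_at_one_of_ne_conj_one` — **the named fact for `n = 1` over `K`,
  unconditionally**;
* `exists_entire_apply_one_ne_zero_eq_partialHeckeL` — **Hecke–Landau over every number field**:
  for a unitary Hecke character `ψ ≠ 1` of `K` trivial on `A_G = ℝ_{>0}` and a finite `S` off which
  `ψ` is unramified, the partial Hecke `L`-function `L^S(s, ψ) = ∏_{v ∉ S} (1 - ψ(ϖ_v) q_v^{-s})⁻¹`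
  extends to an entire function `g` with **`g(1) ≠ 0`** (Iwasawa, *Hecke's `L`-functions*, Thm. 3.1
  with Prop. 4.4: "`L(1 + iy; χ) ≠ 0`", at `y = 0`, for Iwasawa's Hecke characters = characters of
  the idele class group trivial on the diagonal positive reals). Proof: the entire continuations
  `g`, `g'` of `L^S(s, ψ^{±1})` (`exists_entire_eq_partialHeckeL`, with an auxiliary automorphic
  measure of `GL_1`, `AdelicGroupData.exists_isAutomorphicMeasure_gl_holds`) give continuations
  `E_S(s)⁻¹ g`, `E'_S(s)⁻¹ g'` of the full `L(s, ψ^{±1})` to `Re s > 0`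
  (`heckeLFunction_eq_prod_mul_tprod_compl`; the finite Euler products `E_S` do not vanish there),
  and `HeckeCharacter.continuation_apply_one_ne_zero` (Landau's method, `A = 0 < 1/2`) applies;
* `exists_ne_zero_tendsto_partialHeckeL` — the same in the limit form consumed by
  `PairLFunctionPolesGLOneProofs`: `L^S(s, ψ) → c ≠ 0` as `s → 1`, `Re s > 1`. This discharges the
  hypothesis `hT` of `exists_ne_zero_tendsto_partialHeckeL_of_tate` /
  `JacquetShalika1981_partialPairL_at_one_of_ne_conj_one_of_tate` (`PairLFunctionPolesGLOneTateProofs`),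
  and gives a second proof of the first item (`example` at the end).

What is NOT here: ranks `n ≥ 2` of the fact, which in the tree follow from the named facts
`MoeglinWaldspurger1989_partialPairL_entire_of_ne_conj` / `…_of_eq_conj` (continuation of
`L^S(s, π ⊗ σ)` and of `(s - 1) L^S(s, π ⊗ π̃)` into the strip; `PairLFunctionPolesLandauHalfPlane`
shows that continuations to `{Re s > A}`, `A < 1/(2n)`, suffice).

## References

* J. Arthur, L. Clozel, *Simple algebras, base change, and the advanced theory of the trace
  formula*, Ann. of Math. Stud. 120 (1989), Ch. 3 §2, (2.2), p. 171. [ArthurClozelAMS120]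
* K. Iwasawa, *Hecke's `L`-functions* (lectures, Princeton, Spring 1964), SpringerBriefs (2019),
  Thm. 3.1 (PDF p. 58), Prop. 4.4 (PDF p. 72). [Iwasawa2019]
* J. Tate, *Fourier analysis in number fields and Hecke's zeta-functions*, in Cassels–Fröhlich,
  *Algebraic Number Theory* (1967), Ch. XV, Thm. 4.4.1. [TateThesis1967]
* C. Mœglin, J.-L. Waldspurger, *Le spectre résiduel de `GL(n)`*, Ann. Sci. ÉNS (4) 22 (1989),
  Appendice, Corollaire (i)(b), (ii), p. 667. [MoeglinWaldspurger1989]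
-/

noncomputable section

open scoped Topology NNReal
open NumberField IsDedekindDomain MeasureTheory Filter Complex Set

namespace Literature.NumberTheory.Automorphic

open AdelicGroupData GaloisRepresentations

variable {K : Type} [Field K] [NumberField K]

/-! ### Arthur–Clozel (2.2) at `s = 1`, `n = 1`, over every number field -/

section RankOne

variable {μ : Measure (gl 1 K).automorphicQuotient} [(gl 1 K).IsAutomorphicMeasure μ]

/-- **Arthur–Clozel (2.2) at `s = 1` for `GL_1` over every number field `K`, unconditionally.**
The named fact `JacquetShalika1981_partialPairL_at_one_of_ne_conj` holds for `n = 1` over `K`: for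
cuspidal `π, π' ≤ L²_cusp(GL_1(K) A_G \ GL_1(𝔸_K))` with `π ≠ π̄'` and honest Satake families `α`,
`β` off a finite `S`, `L^S(s, π × π') = L^S(s, χ_π χ_{π'})` has a finite **non-zero** limit as
`s → 1`, `Re s > 1`. It is `JacquetShalika1981_partialPairL_at_one_of_ne_conj_of_moeglinWaldspurger`
(de la Vallée Poussin–Landau) fed with the two rank-one continuation theorems of the tree,
`MoeglinWaldspurger1989_partialPairL_entire_of_ne_conj_one` (Hecke: `L^S(s, ψ)` entire for
`ψ ≠ 1`, via Godement–Jacquet in rank one) and `MoeglinWaldspurger1989_partialPairL_of_eq_conj_one`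
(`s (s - 1) ζ_K^S(s)` entire). In print, for `n = 1`: Hecke's continuation (Tate, Thm. 4.4.1) and
`L(1, ψ) ≠ 0` (Iwasawa, Prop. 4.4). This supersedes `…_one_of_tate` (conditional on
`heckeLFunction_hasEntireContinuation_of_not_isNormTwist`) and `…_one_rat` (`K = ℚ`).
[cite: ArthurClozelAMS120, Ch. 3 §2 (2.2)] [cite: Iwasawa2019, Ch. 4 §4.2 Prop. 4.4] -/
theorem JacquetShalika1981_partialPairL_at_one_of_ne_conj_one :
    JacquetShalika1981_partialPairL_at_one_of_ne_conj (n := 1) (K := K) (μ := μ) :=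
  JacquetShalika1981_partialPairL_at_one_of_ne_conj_of_moeglinWaldspurger
    MoeglinWaldspurger1989_partialPairL_entire_of_ne_conj_one
    MoeglinWaldspurger1989_partialPairL_of_eq_conj_one

end RankOne

/-! ### Hecke–Landau: `L^S(1, ψ) ≠ 0` over every number field -/

section HeckeLandau

open scoped Classical in
/-- **Continuation of the full `L(s, ψ)` to `Re s > 0` from an entire continuation of `L^S(s, ψ)`.**
For unitary `ψ` unramified off the finite `T` and `g` entire with `g = L^T(·, ψ)` on `Re s > 1`, the
function `G(s) = (∏_{v ∈ T} (1 - c_v N v^{-s}))⁻¹ g(s)` (`c_v = ψ(ϖ_v)` or `0`) is holomorphic on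
`{Re s > 0}` — the finite Euler product is entire (`differentiable_finset_prod_one_sub_mul_cpow`)
and does not vanish there — and `G = L(·, ψ)` on `Re s > 1`
(`heckeLFunction_eq_prod_mul_tprod_compl`). [cite: NeukirchANT1999, Ch. VII §8 (before (8.5))] -/
theorem exists_differentiableOn_eq_heckeLFunction_of_partial {ψ : HeckeCharacter K}
    (hψ : ψ.IsUnitary) (T : Finset (HeightOneSpectrum (𝓞 K)))
    (hur : ∀ v ∉ (T : Set (HeightOneSpectrum (𝓞 K))), ψ.IsUnramifiedAt v)
    {g : ℂ → ℂ} (hg : Differentiable ℂ g)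
    (hg_eq : ∀ s : ℂ, 1 < s.re → g s =
      ∏' v : {v : HeightOneSpectrum (𝓞 K) // v ∉ (T : Set (HeightOneSpectrum (𝓞 K)))},
        (1 - ψ.valueAtUniformizer v.1 * ((Ideal.absNorm v.1.asIdeal : ℕ) : ℂ) ^ (-s))⁻¹) :
    ∃ G : ℂ → ℂ, DifferentiableOn ℂ G {s : ℂ | 0 < s.re} ∧ G 1 =
        (∏ v ∈ T, (1 - (if ψ.IsUnramifiedAt v then ψ.valueAtUniformizer v else 0) *
          ((Ideal.absNorm v.asIdeal : ℕ) : ℂ) ^ (-(1 : ℂ))))⁻¹ * g 1 ∧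
      ∀ s : ℂ, 1 < s.re → G s = heckeLFunction ψ s := by
  set E : ℂ → ℂ := fun s => ∏ v ∈ T, (1 - (if ψ.IsUnramifiedAt v then ψ.valueAtUniformizer v
    else 0) * ((Ideal.absNorm v.asIdeal : ℕ) : ℂ) ^ (-s)) with hE
  have hEd : Differentiable ℂ E := differentiable_finset_prod_one_sub_mul_cpow T _
  have hE0 : ∀ s ∈ {s : ℂ | 0 < s.re}, E s ≠ 0 := fun s hs =>
    finset_prod_one_sub_mul_cpow_ne_zero T (norm_ite_valueAtUniformizer_le_one hψ) hs
  refine ⟨fun s => (E s)⁻¹ * g s, ?_, rfl, fun s hs => ?_⟩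
  · exact (hEd.differentiableOn.inv hE0).mul hg.differentiableOn
  · have hsplit := heckeLFunction_eq_prod_mul_tprod_compl hψ T hur hs
    rw [Finset.prod_inv_distrib] at hsplit
    show (E s)⁻¹ * g s = heckeLFunction ψ s
    rw [hsplit, hg_eq s hs]

/-- **Hecke–Landau over every number field: `L^S(s, ψ)` is entire and non-zero at `s = 1`.** For a
unitary Hecke character `ψ ≠ 1` of `K` trivial on `A_G = ℝ_{>0}` and a finite set `S` of finite
places off which `ψ` is unramified, the partial Hecke `L`-function
`L^S(s, ψ) = ∏_{v ∉ S} (1 - ψ(ϖ_v) q_v^{-s})⁻¹` (`Re s > 1`) extends to an entire function `g` with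
`g(1) ≠ 0`. Continuation: Hecke–Tate (`exists_entire_eq_partialHeckeL`, Godement–Jacquet in rank
one, with an auxiliary automorphic measure of `GL_1`, `exists_isAutomorphicMeasure_gl_holds`), for
`ψ` and for `ψ⁻¹`; non-vanishing: Landau's method (`HeckeCharacter.continuation_apply_one_ne_zero`
with `A = 0`), applied to the continuations of the full `L(s, ψ^{±1})` to `Re s > 0`
(`exists_differentiableOn_eq_heckeLFunction_of_partial`). In print: Iwasawa, Thm. 3.1 ("if `χ ≢ 1`,
then `L(s; χ)` is holomorphic everywhere") and Prop. 4.4 ("`L(1 + iy; χ) ≠ 0`", here `y = 0`).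
[cite: Iwasawa2019, Thm. 3.1 and Ch. 4 §4.2 Prop. 4.4] [cite: TateThesis1967, Thm. 4.4.1] -/
theorem exists_entire_apply_one_ne_zero_eq_partialHeckeL (ψ : HeckeCharacter K) (hu : ψ.IsUnitary)
    (hA : ∀ t : ℝ≥0ˣ, ψ (posRealIdele K t) = 1) (h1 : ψ ≠ 1)
    {S : Set (HeightOneSpectrum (𝓞 K))} (hS : S.Finite) (hur : ∀ v ∉ S, ψ.IsUnramifiedAt v) :
    ∃ g : ℂ → ℂ, Differentiable ℂ g ∧ g 1 ≠ 0 ∧ ∀ s : ℂ, 1 < s.re →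
      g s = ∏' v : {v : HeightOneSpectrum (𝓞 K) // v ∉ S},
        (1 - ψ.valueAtUniformizer v.1 * ((v.1.residueCard : ℂ) ^ (-s)))⁻¹ := by
  classical
  obtain ⟨T, rfl⟩ : ∃ T : Finset (HeightOneSpectrum (𝓞 K)), (T : Set _) = S :=
    ⟨hS.toFinset, hS.coe_toFinset⟩
  -- an auxiliary automorphic measure of `GL_1`, to realise `ψ` in `L²`
  obtain ⟨μ, hμ⟩ := AdelicGroupData.exists_isAutomorphicMeasure_gl_holds 1 K
  haveI := hμ
  -- `ψ⁻¹` is unitary, trivial on `A_G`, `≠ 1`, unramified off `S`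
  have hu' : ψ⁻¹.IsUnitary := hu.inv
  have hA' : ∀ t : ℝ≥0ˣ, ψ⁻¹ (posRealIdele K t) = 1 := fun t => by
    rw [HeckeCharacter.inv_apply, hA t, inv_one]
  have h1' : ψ⁻¹ ≠ 1 := inv_ne_one.mpr h1
  have hur' : ∀ v ∉ (T : Set (HeightOneSpectrum (𝓞 K))), ψ⁻¹.IsUnramifiedAt v := fun v hv =>
    HeckeCharacter.isUnramifiedAt_inv_iff.mpr (hur v hv)
  -- Hecke's entire continuations of `L^S(s, ψ)` and `L^S(s, ψ⁻¹)`
  obtain ⟨g, hg, hg_eq⟩ := exists_entire_eq_partialHeckeL μ ψ hu hA h1 hS hur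
  obtain ⟨g', hg', hg'_eq⟩ := exists_entire_eq_partialHeckeL μ ψ⁻¹ hu' hA' h1' hS hur'
  -- continuations of the full `L(s, ψ^{±1})` to `Re s > 0`
  obtain ⟨G, hG, hG1, hG_eq⟩ := exists_differentiableOn_eq_heckeLFunction_of_partial hu T hur hg hg_eq
  obtain ⟨G', hG', -, hG'_eq⟩ :=
    exists_differentiableOn_eq_heckeLFunction_of_partial hu' T hur' hg' hg'_eq
  -- Landau: `G(1) ≠ 0`, hence `g(1) ≠ 0`
  have hne : G 1 ≠ 0 :=
    HeckeCharacter.continuation_apply_one_ne_zero hu (A := 0) one_half_pos hG hG_eq hG' hG'_eq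
  rw [hG1] at hne
  exact ⟨g, hg, right_ne_zero_of_mul hne, hg_eq⟩

/-- **Hecke–Landau in limit form** (the hypothesis `h` of
`JacquetShalika1981_partialPairL_at_one_of_ne_conj_one_of_heckeCharacter`, `PairLFunctionPolesGLOneProofs`,
now unconditionally over every number field): for unitary `ψ ≠ 1` trivial on `A_G` and finite `S`
off which `ψ` is unramified, `L^S(s, ψ) → c ≠ 0` as `s → 1`, `Re s > 1` (`c = g(1)` for the entire
continuation `g` of `exists_entire_apply_one_ne_zero_eq_partialHeckeL`).
[cite: Iwasawa2019, Ch. 4 §4.2 Prop. 4.4] -/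
theorem exists_ne_zero_tendsto_partialHeckeL (ψ : HeckeCharacter K) (hu : ψ.IsUnitary)
    (hA : ∀ t : ℝ≥0ˣ, ψ (posRealIdele K t) = 1) (h1 : ψ ≠ 1)
    {S : Set (HeightOneSpectrum (𝓞 K))} (hS : S.Finite) (hur : ∀ v ∉ S, ψ.IsUnramifiedAt v) :
    ∃ c : ℂ, c ≠ 0 ∧ Tendsto (fun s : ℂ => ∏' v : {v : HeightOneSpectrum (𝓞 K) // v ∉ S},
      (1 - ψ.valueAtUniformizer v.1 * ((v.1.residueCard : ℂ) ^ (-s)))⁻¹)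
      (𝓝[{s : ℂ | 1 < s.re}] 1) (𝓝 c) := by
  obtain ⟨g, hg, hg1, hg_eq⟩ := exists_entire_apply_one_ne_zero_eq_partialHeckeL ψ hu hA h1 hS hur
  refine ⟨g 1, hg1, ?_⟩
  have hc : Tendsto g (𝓝[{s : ℂ | 1 < s.re}] 1) (𝓝 (g 1)) :=
    (hg 1).continuousAt.tendsto.mono_left nhdsWithin_le_nhds
  exact hc.congr' (by filter_upwards [self_mem_nhdsWithin] with s hs using hg_eq s hs)

/-- Second proof of `JacquetShalika1981_partialPairL_at_one_of_ne_conj_one`, through the GL_1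
dictionary of `PairLFunctionPolesGLOneProofs` and Hecke–Landau in limit form. [folklore] -/
example {μ : Measure (gl 1 K).automorphicQuotient} [(gl 1 K).IsAutomorphicMeasure μ] :
    JacquetShalika1981_partialPairL_at_one_of_ne_conj (n := 1) (K := K) (μ := μ) :=
  JacquetShalika1981_partialPairL_at_one_of_ne_conj_one_of_heckeCharacter
    fun ψ hu hA h1 _ hS hur => exists_ne_zero_tendsto_partialHeckeL ψ hu hA h1 hS hur

end HeckeLandau

end Literature.NumberTheory.Automorphic
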